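import Summits.BirchSwinnertonDyer.Rank1Residual.Additive.RamifiedSevenGenusFactorisationShape
import Literature.NumberTheory.EllipticCurves.IwasawaAlgebraCharIdealProofs
import Literature.NumberTheory.EllipticCurves.Kato2004.LayerCharacterTwoProofs
import Mathlib.NumberTheory.Basic
import Mathlib.Algebra.CharP.Lemmas
import Mathlib.Algebra.CharP.Algebra
import Mathlib.FieldTheory.Finite.Basic
import HarnessLib

/-!
# `𝒞₇` genus road, block (B2): the genus residue (G6) FROM the factorisation K1ᵘ —
# `GenusFactorisationShape d → GenusResidueNonzeroShape d` for every `𝒞₇`-frame and datum, given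
# Tsuji 1999 Thm 3.1 (i) (Coleman's map), Ferrero–Washington in both printed readings, and LEMMA M (PROVED)

Cell bsd-cm, seat bsd-cm-k-ty1 g23, row (GENUS-PORT-A) block (B2) of the scope `SCOPE-GENUS-PORT-F8.md`
(16530c741a99cc96); memo `MEMO-bsd-cm-genus` v1 (a38f3eedd2c92d58) §8: LEMMA M and (G6) step (1).  THEOREMS ONLY
(no `def`), standard axioms.  HONEST LABEL: a CONDITIONAL theorem on the shapes of
`RamifiedSevenGenusFactorisationShape.lean`; it closes no item and registers no stub; stmt-BirchSwinnertonDyer-19945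
is OPEN; `X12.CMRamifiedSeven` is NOT proved; BSD is claimed for no curve.

## The argument (memo §8 (G6) step (1) + LEMMA M, in the semi-local module `𝓤^{η₁}`)

Let `F` be a `𝒞₇`-frame, `d` a genus datum with `e_{η₁}θ^𝔞 = G_𝔞 · e_{η₁}ξ`, `G_𝔞 = c₀·u·x·Θ` (`c₀ = −½`).
1. Tsuji's theorem (the named fact `tsuji1999_thm31_colemanMap`, case (i): `χ₁ = prim(ω⁴χ_D)`, `χ₁(7) = 0 ≠ 1`),
   instantiated at the frame's binders, gives a `Λ`-isomorphism `Col : 𝓤^{η₁} ≃ Λ` with `Col(𝒞^{η₁}) = (g)`,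
   `g = g_{η₁}` the frame's Kubota–Leopoldt series; since `𝒞^{η₁} = Λ·ξ` (datum pin), `(Col ξ) = (g)`, so
   `Col ξ · w = g` for a unit `w` (`Λ` is a domain).
2. If `θ ∈ 7·𝓤^{η₁}` then `Col θ ∈ 7Λ`, and `G_𝔞 · g = Col θ · w ∈ 7Λ`; `7` is prime in `Λ`
   (`IwasawaAlgebra.prime_C`), so `7 ∣ c₀`, `7 ∣ u`, `7 ∣ x`, `7 ∣ Θ` or `7 ∣ g` — each impossible: `c₀ = −½` and
   `u ∈ {±1, ±2}` are units; `7 ∤ g` is Ferrero–Washington in the `s`-direction (F1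
   `ferreroWashington_kubotaLeopoldtSeries_unitCoeff`, glue `not_C_dvd_of_isKubotaLeopoldtSeries_map`); `7 ∤ Θ` is
   Ferrero–Washington in Lang's printed `ψ`-direction (`ferreroWashington_stickelbergerSeries_unitCoeff`, file
   `IwasawaTheory/StickelbergerSeries.lean`; hypotheses: `η₁ = χ_D ω⁵` even, `≠ 1`, conductor `7|D|` — from the frame);
   and `7 ∤ x` is **LEMMA M**, PROVED here:
3. LEMMA M (memo §8: `μ(N𝔞 − σ_{N𝔞}) = 0`).  The datum pins `x ≡ N𝔞 − η₁(N𝔞)(1 + T)^{r_j} (mod h_j)` for all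
   `j`, `h_j = (1+T)^{7^j} − 1`, `u^{r_j}ω(N𝔞) ≡ N𝔞 (mod 7^{j+1})`.  Suppose `7 ∣ x`.  Reducing mod `7`
   (`ℤ₇⟦T⟧ → 𝔽₇⟦T⟧`, where `h_j ↦ T^{7^j}` by Frobenius) gives `η̄·(1 + T)^{r_j} ≡ N̄𝔞 (mod T^{7^j})`; if
   `7^j ∤ r_j`, write `r_j = 7^v m`, `v < j`, `7 ∤ m`: then `(1 + T)^{r_j} = (1 + T^{7^v})^m` has `T^{7^v}`-coefficient
   `m ≠ 0` in `𝔽₇` while the right side has none — contradiction (`η̄ ≠ 0`).  So `7^j ∣ r_j` for every `j`, whence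
   `u^{r_j} ≡ 1 (mod 7^{j+1})` (`u ≡ 1 mod 7`, `dvd_sub_pow_of_dvd_sub`) and `ω(N𝔞) ≡ N𝔞 (mod 7^{j+1})` for all `j`,
   i.e. `N𝔞 = ω(N𝔞)` in `ℤ₇`; then `N𝔞⁶ = ω(N𝔞⁶) = 1`, so `N𝔞 = 1` — contradicting `N𝔞 ≥ 2` (`𝔞 ≠ O_K`). ∎
No injectivity of a global-to-semilocal map, no residue functional and no orientation convention is used.

## References
Memo §8 (G6), LEMMA M; blueprint `Cruxes/EllipticUnitValueSevenOfGZK/KatoGenusResidueSketch.lean` (5a996a18d1327d07: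
`coleman_detects`, `not_divisible_of_mu_free` — re-proved here on the concrete datum, not imported); T. Tsuji, J.
Number Theory 78 (1999) Thm 3.1 (i) [Tsuji1999]; S. Lang, Cyclotomic Fields I–II (1990) Ch. 10 §1–§2, Thm 2.3
[Lang1990]; B. Ferrero – L. Washington, Ann. Math. 109 (1979) [FerreroWashington1979]; K. Kato, Astérisque 295
(2004) §15.6 [Kato2004Asterisque].
-/

noncomputable section

open scoped NumberField
open PowerSeries IsDedekindDomain
open Literature.NumberTheory.EllipticCurves
open Literature.NumberTheory.EllipticCurves.IwasawaAlgebra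
open Literature.NumberTheory.IwasawaTheory
open Literature.NumberTheory.IwasawaTheory.StickelbergerSeries
open Literature.NumberTheory.ComplexMultiplication.EllipticUnits

namespace Summit.BirchSwinnertonDyer.Rank1Residual.Additive.GenusSeven

/-! ## §1 LEMMA M, the characteristic-`p` core: `(1 + T)^{p^v m}` mod `T^{p^j}` is not constant -/

section CharP

variable {p : ℕ} [Fact p.Prime]

/-- Frobenius in `𝔽_p⟦T⟧`: `(1 + T)^{p^v} = 1 + T^{p^v}`. [cite: Lang1990, Ch. 10 §2 (PDF p. 172, the congruences mod 𝔭)] -/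
theorem one_add_X_pow_prime_pow (v : ℕ) :
    (1 + X : (ZMod p)⟦X⟧) ^ (p ^ v) = 1 + X ^ (p ^ v) := by
  haveI : CharP (ZMod p)⟦X⟧ p := charP_of_injective_ringHom (PowerSeries.C_injective) p
  rw [add_pow_char_pow, one_pow]

/-- The `T^{a}`-coefficient of `(1 + T^{a})^m` is `m` (`a ≥ 1`). [cite: Lang1990, Ch. 10 §2 (PDF p. 171, formula (2))] -/
theorem coeff_one_add_X_pow_pow {R : Type*} [CommRing R] {a : ℕ} (ha : 0 < a) (m : ℕ) :
    coeff a ((1 + X ^ a : R⟦X⟧) ^ m) = m := by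
  rw [add_comm, add_pow, map_sum]
  simp_rw [one_pow, mul_one, ← pow_mul, ← map_natCast (C : R →+* R⟦X⟧), coeff_mul_C, coeff_X_pow]
  rw [Finset.sum_eq_single 1]
  · simp
  · intro i _ hi
    rw [if_neg, zero_mul]
    intro h
    exact hi (Nat.eq_of_mul_eq_mul_left ha (h.symm.trans (mul_one a).symm))
  · intro h
    have hm : m = 0 := by simpa [Finset.mem_range] using h
    subst hm
    simp

/-- **The core of LEMMA M.**  In `𝔽_p⟦T⟧`: if `c ≠ 0` and `c·(1 + T)^r = N + T^{p^j}·q`, then `p^j ∣ r`.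
[cite: Lang1990, Ch. 10 §2 Thm. 2.2 (PDF p. 172)] -/
theorem prime_pow_dvd_of_C_mul_one_add_X_pow_eq {c N : ZMod p} (hc : c ≠ 0) {r j : ℕ} {q : (ZMod p)⟦X⟧}
    (h : C c * (1 + X) ^ r = C N + X ^ (p ^ j) * q) : p ^ j ∣ r := by
  have hp : p.Prime := Fact.out
  by_contra hnd
  have hr : r ≠ 0 := by rintro rfl; exact hnd (dvd_zero _)
  obtain ⟨v, m, hm, rfl⟩ := Nat.exists_eq_pow_mul_and_not_dvd hr p hp.one_lt.ne'
  have hvj : v < j := by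
    by_contra hvj
    exact hnd (dvd_mul_of_dvd_left (pow_dvd_pow p (not_lt.mp hvj)) m)
  have hkey := congrArg (coeff (p ^ v)) h
  have lhs : coeff (p ^ v) (C c * (1 + X : (ZMod p)⟦X⟧) ^ (p ^ v * m)) = c * m := by
    rw [pow_mul, one_add_X_pow_prime_pow, coeff_C_mul, coeff_one_add_X_pow_pow (pow_pos hp.pos v)]
  have rhs : coeff (p ^ v) (C N + X ^ (p ^ j) * q) = 0 := by
    rw [map_add, coeff_C, if_neg (pow_pos hp.pos v).ne', coeff_X_pow_mul',
      if_neg (not_le.mpr (Nat.pow_lt_pow_right hp.one_lt hvj)), add_zero]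
  rw [lhs, rhs, mul_eq_zero] at hkey
  rcases hkey with hkey | hkey
  · exact hc hkey
  · exact hm ((ZMod.natCast_eq_zero_iff m p).mp hkey)

end CharP

/-! ## §2 LEMMA M, the `7`-adic part: `7^j ∣ r_j` for all `j` forces `N𝔞 = ω(N𝔞)`, hence `N𝔞 = 1` -/

section SevenAdic

variable {p : ℕ} [Fact p.Prime]

/-- `u ≡ 1 (mod p)` and `p^j ∣ r` give `u^r ≡ 1 (mod p^{j+1})`. [cite: Lang1990, Ch. 10 §1 (PDF p. 167, «γ mod pⁿ generates 1 + pℤ_p mod pⁿ»)] -/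
theorem pow_sub_one_mem_span_of_dvd {u : ℤ_[p]} (hu : (p : ℤ_[p]) ∣ u - 1) {j r : ℕ} (hr : p ^ j ∣ r) :
    u ^ r - 1 ∈ Ideal.span {(p : ℤ_[p]) ^ (j + 1)} := by
  obtain ⟨k, rfl⟩ := hr
  rw [Ideal.mem_span_singleton]
  have h1 : (p : ℤ_[p]) ^ (j + 1) ∣ u ^ p ^ j - 1 := by
    simpa using dvd_sub_pow_of_dvd_sub hu j
  rw [pow_mul]
  exact h1.trans (by simpa using sub_dvd_pow_sub_pow (u ^ p ^ j) 1 k)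

/-- An element of `ℤ_p` divisible by every power of `p` is `0`. [cite: Lang1990, Ch. 10 §1 (PDF p. 168, Iwasawa invariants)] -/
theorem eq_zero_of_forall_mem_span_pow {z : ℤ_[p]} (h : ∀ j : ℕ, z ∈ Ideal.span {(p : ℤ_[p]) ^ (j + 1)}) :
    z = 0 := by
  by_contra hz
  have := (PadicInt.mem_span_pow_iff_le_valuation z hz _).mp (h z.valuation)
  omega

end SevenAdic

/-! ## §3 LEMMA M on the datum: `7 ∤ x` -/

section LemmaM

variable {F : GenusFrame} {θu : ∀ n : ℕ, globalUnitsOf (F.layer n)} (d : GenusDatum F θu)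

/-- `η₁(N𝔞) = χ_D(N𝔞)ω(N𝔞)⁵` is a unit of `ℤ₇` (`N𝔞` prime to `7|D|`). [cite: Tsuji1999, §4 (p. 12, «χ = φω^i»)] -/
theorem GenusFrame.isUnit_etaOneNormA (F : GenusFrame) : IsUnit F.etaOneNormA := by
  rw [GenusFrame.etaOneNormA_def]
  refine IsUnit.mul ?_ (IsUnit.pow 5 ?_)
  · have hu : IsUnit (F.normA : ZMod F.d) := by
      rw [← ZMod.coe_unitOfCoprime F.normA F.normA_coprime_d]; exact Units.isUnit _
    exact hu.map F.χD
  · have hu : IsUnit (F.normA : ZMod 7) := by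
      rw [← ZMod.coe_unitOfCoprime F.normA F.normA_coprime_seven]; exact Units.isUnit _
    exact hu.map F.ω

/-- `u ≡ 1 (mod 7)` for the frame's topological generator. [cite: Lang1990, Ch. 10 §1 (PDF p. 167)] -/
theorem GenusFrame.seven_dvd_u_sub_one (F : GenusFrame) : ((7 : ℕ) : ℤ_[7]) ∣ (F.u : ℤ_[7]) - 1 :=
  (PadicInt.norm_lt_one_iff_dvd _).mp (F.u_topGenerator.norm_sub_one_lt_one)

/-- `ω(N𝔞)⁶ = 1` (a character of `(ℤ/7)^×` at a unit). [cite: Lang1990, Ch. 10 §1 (PDF p. 167, η ∈ μ_{p−1})] -/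
theorem GenusFrame.omega_normA_pow_six (F : GenusFrame) : F.ω (F.normA : ZMod 7) ^ 6 = 1 := by
  have hne : (F.normA : ZMod 7) ≠ 0 := by
    rw [Ne, ZMod.natCast_eq_zero_iff]
    intro h
    have := Nat.Coprime.eq_one_of_dvd F.normA_coprime_seven.symm h
    omega
  rw [← map_pow, show (6 : ℕ) = 7 - 1 from rfl, ZMod.pow_card_sub_one_eq_one hne, map_one]

/-- **LEMMA M** (memo §8): the image `x` of `N𝔞 − σ_{N𝔞}` on the `η₁`-line is `μ`-free — `7 ∤ x` in `Λ = ℤ₇⟦T⟧`.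
[cite: Kato2004Asterisque, §15.6 (p. 254, the factor N(𝔞) − σ_𝔞)] [cite: Lang1990, Ch. 10 §2 Thm. 2.2 (PDF p. 172)] -/
theorem GenusDatum.not_C_seven_dvd_x : ¬ (C (7 : ℤ_[7]) : IwasawaAlgebra 7) ∣ d.x := by
  rintro ⟨y, hy⟩
  -- Step 1: for every `j`, `7^j ∣ r_j(N𝔞)`.
  have key : ∀ j : ℕ, 7 ^ j ∣ F.r j F.normA := by
    intro j
    obtain ⟨q, hq⟩ := Ideal.mem_span_singleton'.mp (d.x_spec j)
    -- reduce mod 7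
    let π : IwasawaAlgebra 7 →+* (ZMod 7)⟦X⟧ := PowerSeries.map (PadicInt.toZMod (p := 7))
    have h7 : π (C (7 : ℤ_[7])) = 0 := by
      simp only [π, map_C]
      rw [show (7 : ℤ_[7]) = ((7 : ℕ) : ℤ_[7]) by norm_cast, map_natCast, ZMod.natCast_self, map_zero]
    have hπh : π (layerModulus 7 j) = X ^ (7 ^ j) := by
      simp only [π, layerModulus_def, map_sub, map_pow, map_add, map_one, map_X, one_add_X_pow_prime_pow,
        add_sub_cancel_left]
    have hq' := congrArg π hq
    rw [map_mul, hπh, map_sub, hy, map_mul, h7, zero_mul, zero_sub, map_sub, map_mul, map_pow, map_add, map_one,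
      map_X] at hq'
    simp only [π, map_C] at hq'
    -- `hq' : q̄ * X^{7^j} = -(C N̄ - C c̄ (1+X)^r)`
    refine prime_pow_dvd_of_C_mul_one_add_X_pow_eq (p := 7) (c := PadicInt.toZMod F.etaOneNormA)
      (N := PadicInt.toZMod (F.normA : ℤ_[7])) (q := π q) ?_ ?_
    · exact (F.isUnit_etaOneNormA.map _).ne_zero
    · rw [mul_comm (X ^ (7 ^ j)), hq']; ring
  -- Step 2: `ω(N𝔞) - N𝔞 ∈ (7^{j+1})` for every `j`, hence `ω(N𝔞) = N𝔞` in `ℤ₇`.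
  have cong : ∀ j : ℕ, F.ω (F.normA : ZMod 7) - (F.normA : ℤ_[7]) ∈ Ideal.span {((7 : ℕ) : ℤ_[7]) ^ (j + 1)} := by
    intro j
    have h1 := F.r_logTable j F.normA F.normA_coprime_seven
    have h2 := pow_sub_one_mem_span_of_dvd F.seven_dvd_u_sub_one (key j)
    have : F.ω (F.normA : ZMod 7) - (F.normA : ℤ_[7]) =
        ((F.u : ℤ_[7]) ^ F.r j F.normA * F.ω (F.normA : ZMod 7) - F.normA) -
          ((F.u : ℤ_[7]) ^ F.r j F.normA - 1) * F.ω (F.normA : ZMod 7) := by ring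
    rw [this]
    exact Ideal.sub_mem _ h1 (Ideal.mul_mem_right _ _ h2)
  have heq : F.ω (F.normA : ZMod 7) = (F.normA : ℤ_[7]) :=
    sub_eq_zero.mp (eq_zero_of_forall_mem_span_pow cong)
  -- Step 3: `N𝔞⁶ = 1`, so `N𝔞 = 1`.
  have h6 : ((F.normA ^ 6 : ℕ) : ℤ_[7]) = 1 := by
    rw [Nat.cast_pow, ← heq, F.omega_normA_pow_six]
  have h1 : F.normA ^ 6 = 1 := by exact_mod_cast h6
  have := F.two_le_normA
  rw [pow_eq_one_iff] at h1
  omega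

end LemmaM

/-! ## §4 The inputs at the frame: Coleman's map (Tsuji), `7 ∤ g` (FW, `s`-direction), `7 ∤ Θ` (FW, `ψ`-direction) -/

section Inputs

variable (F : GenusFrame) {θu : ∀ n : ℕ, globalUnitsOf (F.layer n)} (d : GenusDatum F θu)

/-- **Tsuji's theorem at the genus frame**: a `Λ`-isomorphism `Col : 𝓤^{η₁} ≃ Λ` with `Col(𝒞^{η₁}) = (g_{η₁})`.
[cite: Tsuji1999, Thm. 3.1 (i) (p. 6) and Prop. 5.2 (a)(i) (p. 16)] -/
theorem GenusFrame.exists_colemanMap (h₄ : tsuji1999_thm31_colemanMap) :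
    ∃ Col : F.U.chiPart F.η₁ ≃ₗ[IwasawaAlgebra 7] IwasawaAlgebra 7,
      (F.U.cycChi F.η₁).map Col.toLinearMap = Ideal.span {F.g} := by
  haveI : NeZero F.d := ⟨F.d_ne_zero⟩
  have hζ : IsPrimitiveRoot (F.ζsys 0) (F.d * 7) := by
    have := F.ζsys_compatible.1 0
    rwa [zero_add, pow_one, mul_comm] at this
  exact h₄ 7 (by decide) F.v F.seven_mem_v F.d F.d_pos F.d_coprime_seven F.F₀ F.F₀_le (F.ζsys 0) hζ F.u
    F.u_topGenerator F.γ₀ F.cyclotomicCharacter_γ₀ F.γ₀_mem F.η₁ F.η₁_trivial F.d dvd_rfl F.χD F.χD_isPrimitive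
    F.ω F.ω_teichmuller 5 GenusFrame.five_le F.nontrivial_reading F.χD_neg_one_eq_pow F.η₁_reading F.chiOneAtP_ne_one
    F.g F.g_spec F.U

/-- `intAlgebraMap 7 : ℤ₇ → ℂ₇` is injective (it is norm-preserving). [cite: Lang1990, Ch. 10 §1 (PDF p. 167, 𝔬 ⊂ ℂ_p)] -/
theorem intAlgebraMap_injective : Function.Injective (KubotaLeopoldt.intAlgebraMap 7) := by
  refine (injective_iff_map_eq_zero _).mpr fun x hx => ?_
  have h := KubotaLeopoldt.norm_intAlgebraMap 7 x
  rw [hx, norm_zero] at h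
  exact norm_eq_zero.mp h.symm

/-- **Ferrero–Washington, `s`-direction, at the frame: `7 ∤ g_{η₁}`.**
[cite: Lang1990, Ch. 10 §2 Thm. 2.3 (PDF p. 172)] [cite: FerreroWashington1979, Theorem (p. 377)] -/
theorem GenusFrame.not_C_seven_dvd_g (h₂ : ferreroWashington_kubotaLeopoldtSeries_unitCoeff) :
    ¬ (C (7 : ℤ_[7]) : IwasawaAlgebra 7) ∣ F.g := by
  haveI : NeZero F.d := ⟨F.d_ne_zero⟩
  have hφ : DirichletCharacter.IsPrimitive (F.χD.ringHomComp (KubotaLeopoldt.intAlgebraMap 7)) :=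
    (Kato2004.LayerCharacterTwo.isPrimitive_ringHomComp_iff F.χD intAlgebraMap_injective).mpr F.χD_isPrimitive
  have heven : (F.χD.ringHomComp (KubotaLeopoldt.intAlgebraMap 7)) (-1) = (-1) ^ 5 := by
    rw [MulChar.ringHomComp_apply, F.χD_neg_one_eq_pow, map_pow, map_neg, map_one]
  have h := not_C_dvd_of_isKubotaLeopoldtSeries_map h₂ (by decide) F.d_coprime_seven hφ GenusFrame.five_le
    F.nontrivial_reading heven F.u_topGenerator F.g_spec
  rwa [show ((7 : ℕ) : ℤ_[7]) = 7 by norm_cast] at h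

/-- `ω(−1) = −1` for the Teichmüller character. [cite: Lang1990, Ch. 10 §2 (PDF p. 171, «θω⁻¹ is odd»)] -/
theorem GenusFrame.omega_neg_one : F.ω (-1) = -1 := by
  have hsq : F.ω (-1) * F.ω (-1) = 1 := by rw [← map_mul, neg_mul_neg, one_mul, map_one]
  rcases mul_self_eq_one_iff.mp hsq with h | h
  · exfalso
    have ht := F.ω_teichmuller (-1)
    rw [Units.val_neg, Units.val_one, h, map_one] at ht
    exact absurd ht (by decide)
  · exact h

/-- **`η₁ = χ_D·ω⁵` is even** (mod `7|D|`): `χ_D(−1)·ω(−1)⁵ = (−1)(−1)⁵ = 1`. [cite: Lang1990, Ch. 10 §2 (PDF p. 171, «θ = even character»)] -/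
theorem GenusFrame.etaOneDirichlet_even : F.etaOneDirichlet.Even := by
  haveI : NeZero F.d := ⟨F.d_ne_zero⟩
  rw [DirichletCharacter.Even, GenusFrame.etaOneDirichlet_def, MulChar.mul_apply]
  have h1 : DirichletCharacter.changeLevel (Dvd.intro 7 rfl) F.χD (-1 : ZMod (F.d * 7)) = -1 := by
    have := DirichletCharacter.changeLevel_eq_cast_of_dvd' F.χD (Dvd.intro 7 rfl) (a := -1)
      (Int.isCoprime_iff_gcd_eq_one.mpr (by simp))
    push_cast at this
    rw [this, F.χD_neg_one]
  have h2 : (DirichletCharacter.changeLevel (Dvd.intro_left F.d rfl) F.ω ^ 5) (-1 : ZMod (F.d * 7)) = -1 := by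
    have hunit : IsUnit (-1 : ZMod (F.d * 7)) := isUnit_one.neg
    rw [← hunit.unit_spec, MulChar.pow_apply_coe, hunit.unit_spec]
    have := DirichletCharacter.changeLevel_eq_cast_of_dvd' F.ω (Dvd.intro_left F.d rfl) (a := -1)
      (Int.isCoprime_iff_gcd_eq_one.mpr (by simp))
    push_cast at this
    rw [this, F.omega_neg_one]
    norm_num
  rw [h1, h2]
  norm_num

/-- `η₁ ≠ 1` (it is primitive of conductor `7|D| > 1`). [cite: Lang1990, Ch. 10 §2 (PDF p. 171, «θ ≠ 1»)] -/
theorem GenusFrame.etaOneDirichlet_ne_one : F.etaOneDirichlet ≠ 1 := by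
  haveI : NeZero (F.d * 7) := ⟨Nat.mul_ne_zero F.d_ne_zero (by norm_num)⟩
  intro h
  have hc := (DirichletCharacter.eq_one_iff_conductor_eq_one).mp h
  rw [F.etaOneDirichlet_isPrimitive] at hc
  have := F.d_pos
  omega

/-- **Ferrero–Washington, Lang's `ψ`-direction, at the frame: `7 ∤ Θ`.**
[cite: Lang1990, Ch. 10 §2 Thm. 2.3 (PDF p. 172)] [cite: FerreroWashington1979, Theorem (p. 377)] -/
theorem GenusDatum.not_C_seven_dvd_Theta (h₂' : ferreroWashington_stickelbergerSeries_unitCoeff) :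
    ¬ (C (7 : ℤ_[7]) : IwasawaAlgebra 7) ∣ d.Θ := by
  have h := ferreroWashington_stickelbergerSeries_unitCoeff.not_C_dvd h₂' (p := 7) (by decide) F.d_pos
    F.d_coprime_seven F.etaOneDirichlet_ne_one F.etaOneDirichlet_even F.etaOneDirichlet_conductor F.ω_teichmuller
    F.u_topGenerator F.r_logTable d.Θ_spec
  rwa [show ((7 : ℕ) : ℤ_[7]) = 7 by norm_cast] at h

end Inputs

/-! ## §5 (G6): the residue from the factorisation -/

section Residue

variable {F : GenusFrame} {θu : ∀ n : ℕ, globalUnitsOf (F.layer n)} (d : GenusDatum F θu)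

/-- `7 = C 7` is prime in `Λ = ℤ₇⟦T⟧`. [cite: Lang1990, Ch. 10 §1 (PDF p. 168, 𝔬⟦X⟧/p)] -/
theorem prime_C_seven : Prime (C (7 : ℤ_[7]) : IwasawaAlgebra 7) := by
  have h := IwasawaAlgebra.prime_C 7
  rwa [show ((7 : ℕ) : ℤ_[7]) = 7 by norm_cast] at h

/-- The genus factor is `μ`-free: `7 ∤ G_𝔞 = c₀·u·x·Θ` (units `c₀ = −½`, `u`; LEMMA M; Ferrero–Washington for `Θ`).
[cite: Lang1990, Ch. 10 §2 Thm. 2.3 (PDF p. 172)] [cite: Kato2004Asterisque, §15.6 (p. 254)] -/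
theorem GenusDatum.not_C_seven_dvd_genusFactor (h₂' : ferreroWashington_stickelbergerSeries_unitCoeff) :
    ¬ (C (7 : ℤ_[7]) : IwasawaAlgebra 7) ∣ d.genusFactor := by
  have hP := prime_C_seven
  rw [GenusDatum.genusFactor_def]
  intro h
  rcases hP.dvd_or_dvd h with h | h
  · rcases hP.dvd_or_dvd h with h | h
    · rcases hP.dvd_or_dvd h with h | h
      · exact hP.not_unit (isUnit_of_dvd_unit h (GenusDatum.isUnit_cZero.map C))
      · exact hP.not_unit (isUnit_of_dvd_unit h (d.isUnit_ub.map C))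
    · exact d.not_C_seven_dvd_x h
  · exact d.not_C_seven_dvd_Theta F h₂' h

/-- **Coleman detects `7`-divisibility** (memo §8 (G6) step (1), blueprint `coleman_detects` re-proved on the datum):
under K1ᵘ, if `e_{η₁}θ^𝔞 = 7·y` in `𝓤^{η₁}` then `7 ∣ G_𝔞·g_{η₁}` in `Λ`. [cite: Tsuji1999, Thm. 3.1 (i) (p. 6)] -/
theorem GenusDatum.C_seven_dvd_genusFactor_mul_g (h₄ : tsuji1999_thm31_colemanMap) (hK1 : GenusFactorisationShape d)
    {y : F.U.chiPart F.η₁} (hy : d.θ = (C (7 : ℤ_[7]) : IwasawaAlgebra 7) • y) :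
    (C (7 : ℤ_[7]) : IwasawaAlgebra 7) ∣ d.genusFactor * F.g := by
  obtain ⟨Col, hCol⟩ := F.exists_colemanMap h₄
  -- `(Col ξ) = (g)` as ideals, so `Col ξ * w = g` for a unit `w`
  rw [d.cycChi_eq_span, Submodule.map_span, Set.image_singleton] at hCol
  obtain ⟨w, hw⟩ := Ideal.span_singleton_eq_span_singleton.mp hCol
  have h1 : Col d.θ = d.genusFactor * Col d.ξ := by rw [hK1, map_smul, smul_eq_mul]
  have h2 : Col d.θ = C (7 : ℤ_[7]) * Col y := by rw [hy, map_smul, smul_eq_mul]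
  refine ⟨Col y * w, ?_⟩
  calc d.genusFactor * F.g = d.genusFactor * (Col.toLinearMap d.ξ * w) := by rw [hw]
    _ = Col d.θ * w := by rw [LinearEquiv.coe_coe, h1, mul_assoc]
    _ = C (7 : ℤ_[7]) * (Col y * w) := by rw [h2, mul_assoc]

/-- **(B2) THE GENUS RESIDUE FROM THE FACTORISATION** (memo §8 (G6) + LEMMA M): for every `𝒞₇`-frame `F`, every
global family `θu` and every datum `d`, K1ᵘ's identity `e_{η₁}θ^𝔞 = G_𝔞·e_{η₁}ξ` implies that the class of
`e_{η₁}θ^𝔞` in `𝓤^{η₁}/7𝓤^{η₁}` is non-zero — GIVEN Tsuji 1999 Thm 3.1 (i) (Coleman's map) and Ferrero–Washington in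
its two printed readings (`s`-direction for `g_{η₁}`, `ψ`-direction for the Stickelberger series `Θ`); LEMMA M is
proved above.  Conditional theorem; nothing about BSD is claimed.
[cite: Tsuji1999, Thm. 3.1 (i) (p. 6)] [cite: Lang1990, Ch. 10 §2 Thm. 2.3 (PDF p. 172)] [cite: FerreroWashington1979, Theorem (p. 377)] -/
theorem genusResidueNonzero_of_factorisation (h₄ : tsuji1999_thm31_colemanMap)
    (h₂ : ferreroWashington_kubotaLeopoldtSeries_unitCoeff) (h₂' : ferreroWashington_stickelbergerSeries_unitCoeff)
    (F : GenusFrame) (θu : ∀ n : ℕ, globalUnitsOf (F.layer n)) (d : GenusDatum F θu)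
    (hK1 : GenusFactorisationShape d) : GenusResidueNonzeroShape d := by
  rw [genusResidueNonzeroShape_iff_not_exists]
  rintro ⟨y, hy⟩
  rcases prime_C_seven.dvd_or_dvd (d.C_seven_dvd_genusFactor_mul_g h₄ hK1 hy) with h | h
  · exact d.not_C_seven_dvd_genusFactor h₂' h
  · exact F.not_C_seven_dvd_g h₂ h

/-- The same, packaged over all frames and data (the form a skeleton consumes by `exact`).
[cite: Tsuji1999, Thm. 3.1 (i) (p. 6)] [cite: Lang1990, Ch. 10 §2 Thm. 2.3 (PDF p. 172)] -/
theorem genusFactorisationShape_imp_genusResidueNonzeroShape (h₄ : tsuji1999_thm31_colemanMap)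
    (h₂ : ferreroWashington_kubotaLeopoldtSeries_unitCoeff) (h₂' : ferreroWashington_stickelbergerSeries_unitCoeff) :
    ∀ (F : GenusFrame) (θu : ∀ n : ℕ, globalUnitsOf (F.layer n)) (d : GenusDatum F θu),
      GenusFactorisationShape d → GenusResidueNonzeroShape d :=
  fun F θu d h => genusResidueNonzero_of_factorisation h₄ h₂ h₂' F θu d h

end Residue

end Summit.BirchSwinnertonDyer.Rank1Residual.Additive.GenusSeven

end
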